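import Mathlib.Geometry.Euclidean.Angle.Unoriented.Basic
import Mathlib.Analysis.InnerProductSpace.PiL2

/-!
# Tammes reading of a spherical-code bound

Framing: lottery ticket; floor = certified bounds/negative ranges. Venture `PackingBounds`
(cell `pub-packcert`), spherical-codes / Tammes rows (tables B2b, B2d).

The cell certifies statements of the form "every finite set of unit vectors of `ℝⁿ` with pairwise
inner products `≤ s` has at most `N` elements" (`A(n, arccos s) ≤ N`; e.g. the kernel rows
`ThreePointCert.C4F.code_dim4_fifth_le_10_sdp` and the Tammes rows). This
file records the elementary translation into the Tammes form used in the tables: among any `N + 1`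
(or more) unit vectors of `ℝⁿ` two distinct ones have inner product `> s`, i.e. make an
(unoriented) angle `< arccos s` — so the maximal minimum angle of `N + 1` points on `S^{n-1}`
satisfies `θ(N+1) < arccos s` (tables print `θ(N+1) ≤ arccos s`). [folklore]
-/

noncomputable section

open Finset
open scoped RealInnerProductSpace

namespace Summit.Ventures.PackingBounds.SphericalCodes

/-- **Tammes reading, inner-product form**: if `A(n, arccos s) ≤ N`, then among more than `N` unit
vectors of `ℝⁿ` two distinct ones have inner product `> s`. [folklore] -/
theorem exists_inner_gt_of_codeBound {n : ℕ} {s : ℝ} {N : ℕ}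
    (h : ∀ C : Finset (EuclideanSpace ℝ (Fin n)), (∀ x ∈ C, ‖x‖ = 1) →
      (∀ x ∈ C, ∀ y ∈ C, x ≠ y → inner ℝ x y ≤ s) → C.card ≤ N)
    (C : Finset (EuclideanSpace ℝ (Fin n))) (h1 : ∀ x ∈ C, ‖x‖ = 1) (hC : N < C.card) :
    ∃ x ∈ C, ∃ y ∈ C, x ≠ y ∧ s < inner ℝ x y := by
  by_contra hne
  push Not at hne
  exact absurd (h C h1 hne) (by omega)

/-- **Tammes reading, angle form**: if `A(n, arccos s) ≤ N` with `-1 ≤ s`, then among more than `N`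
unit vectors of `ℝⁿ` two distinct ones make an angle `< arccos s`
(`InnerProductGeometry.angle`, in `[0, π]`). [folklore] -/
theorem exists_angle_lt_arccos_of_codeBound {n : ℕ} {s : ℝ} {N : ℕ}
    (h : ∀ C : Finset (EuclideanSpace ℝ (Fin n)), (∀ x ∈ C, ‖x‖ = 1) →
      (∀ x ∈ C, ∀ y ∈ C, x ≠ y → inner ℝ x y ≤ s) → C.card ≤ N)
    (hs : -1 ≤ s) (C : Finset (EuclideanSpace ℝ (Fin n))) (h1 : ∀ x ∈ C, ‖x‖ = 1)
    (hC : N < C.card) :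
    ∃ x ∈ C, ∃ y ∈ C, x ≠ y ∧ InnerProductGeometry.angle x y < Real.arccos s := by
  obtain ⟨x, hx, y, hy, hxy, hlt⟩ := exists_inner_gt_of_codeBound h C h1 hC
  refine ⟨x, hx, y, hy, hxy, ?_⟩
  have hxy1 : inner ℝ x y ≤ 1 := by
    have h := real_inner_le_norm x y
    rw [h1 x hx, h1 y hy, mul_one] at h
    exact h
  unfold InnerProductGeometry.angle
  rw [h1 x hx, h1 y hy, mul_one, div_one]
  exact Real.arccos_lt_arccos hs hlt hxy1

/-- The minimum pairwise angle of a configuration with more than `N` points is `< arccos s`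
whenever `A(n, arccos s) ≤ N`: phrased with an arbitrary lower bound `θ` on all pairwise angles
(the Tammes objective), `θ < arccos s`. [folklore] -/
theorem minAngle_lt_arccos_of_codeBound {n : ℕ} {s : ℝ} {N : ℕ}
    (h : ∀ C : Finset (EuclideanSpace ℝ (Fin n)), (∀ x ∈ C, ‖x‖ = 1) →
      (∀ x ∈ C, ∀ y ∈ C, x ≠ y → inner ℝ x y ≤ s) → C.card ≤ N)
    (hs : -1 ≤ s) (C : Finset (EuclideanSpace ℝ (Fin n))) (h1 : ∀ x ∈ C, ‖x‖ = 1)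
    (hC : N < C.card) (θ : ℝ)
    (hθ : ∀ x ∈ C, ∀ y ∈ C, x ≠ y → θ ≤ InnerProductGeometry.angle x y) : θ < Real.arccos s := by
  obtain ⟨x, hx, y, hy, hxy, hlt⟩ := exists_angle_lt_arccos_of_codeBound h hs C h1 hC
  exact (hθ x hx y hy hxy).trans_lt hlt

end Summit.Ventures.PackingBounds.SphericalCodes

end
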